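import Summits.ResolutionOfSingularities.ResolutionOfSingularities.Theorems.DescentDescentPerfectToAllFiniteLevels
import Literature.AlgebraicGeometry.Resolution.FieldsJ2
import Literature.AlgebraicGeometry.Resolution.JacobianRegularLocus
import Mathlib.RingTheory.Ideal.MinimalPrime.Noetherian
import Mathlib.LinearAlgebra.TensorProduct.Finiteness

/-!
# `DescentPerfectToAll` (stmt-ResolutionOfSingularities-0549): the singular locus of a ground-field
# tower descends to a finite level, uniformly

Route `ResolutionOfSingularities/Descent`, crux `DescentPerfectToAll` ("resolution over all PERFECT
fields of characteristic `p` implies resolution over ALL fields of characteristic `p`"). Helper file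
(OURS; `--supports` the crux, does not close it; NOT a statement of any manuscript; replaces nothing
printed).

## What is proved (ring level, characteristic-free)

Let `K → k` be an extension of fields and `B` a finitely generated `K`-algebra; for an intermediate
level `K → E → k` write `ι_E : B ⊗_K E → B ⊗_K k` for the base-change map. The only mechanism on
record for the crux (tree `STRATEGY-CENSUS.md` of the crux, §0–§2) resolves a model of `X/k` over a
finitely generated level and base-changes it up the tower `k = ⋃ E`; its obstruction is that
regularity is not stable under the inseparable steps `E → k` (barrier
`Literature.Barriers.ResolutionOfSingularities.RegularNotGeometricallyRegular`: a point of the level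
can be regular while the points of `X_k` above it are singular). This file proves that the
obstruction disappears for the MODELS THEMSELVES once the level is high enough, uniformly on
`Spec`:

* `isRegularLocalRing_localization_comap_lTensor` — DESCENT at every level: if `(B ⊗_K k)_𝔓` is
  regular then `(B ⊗_K E)_{ι_E⁻¹ 𝔓}` is regular (flat local descent, Matsumura 23.7 (i)).
* `isOpen_regularLocus_tensor` — `Reg (B ⊗_K k)` is open (fields are J-2, tree `FieldsJ2`).
* `exists_finset_isRegularLocalRing_of_level` — **UNIFORM ASCENT AT HIGH LEVELS**: there is a
  finite `C ⊆ k` such that for every level `E` whose image in `k` contains `C` and every prime `𝔓`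
  of `B ⊗_K k`, regularity of `(B ⊗_K E)_{ι_E⁻¹ 𝔓}` implies regularity of `(B ⊗_K k)_𝔓`. Proof:
  the singular locus `Z = Spec (B ⊗_K k) ∖ Reg` is closed with finitely many generic points
  `𝔮₁, …, 𝔮_r` (minimal primes of its vanishing ideal, Noetherian); `C` = the scalars occurring in
  generators of the `𝔮_i`. For `E ⊇ C` each `𝔮_i` is extended from `B ⊗_K E`, so if the level were
  regular at `ι_E⁻¹ 𝔮_i` then `(B ⊗_K k)_{𝔮_i}` would be regular (flat local map with trivial closed
  fibre, Matsumura 23.7 (ii), tree `isRegularLocalRing_localization_of_le_map_comap`) — so the level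
  is singular below every generic point of `Z`, hence (Serre: the regular locus is stable under
  generalization, tree `mem_regularLocus_of_le`) below every point of `Z`.
* `exists_finset_isRegularLocalRing_iff_level` — hence `Sing (B ⊗_K k) = ι_E^{*-1} Sing (B ⊗_K E)`
  pointwise: `(B ⊗_K k)_𝔓` regular ⟺ `(B ⊗_K E)_{ι_E⁻¹ 𝔓}` regular, for all `E ⊇ C`.
* `exists_finset_forall_isRegularLocalRing_iff_level` — in particular `B ⊗_K k` has all local rings
  regular iff `B ⊗_K E` does, for every `E ⊇ C` (for low levels only `⟸` fails, `⟹` always holds).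

Reading for the crux (k imperfect, `k = ⋃ K_m` a tower of finitely generated fields, `X_m` the
models of `X_k`): for `m ≫ 0`, `Reg(X_m) ×_{K_m} k = Reg(X_k)` — the models stop acquiring new
singularities ("Kollár points") up the tower; this is the corollary «no defects on the regular locus»
of `STRATEGY-CENSUS.md` §2.2, obtained there from cotangent stability, here by an elementary route.
It does NOT touch the resolutions of the models (whose exceptional loci may still be non-robust at
every fixed level, ibid. §2.4).

[cite: Matsumura1987, Thm. 23.7 and §30 Cor. to Thm. 30.5] [folklore]
-/

noncomputable section

set_option linter.dupNamespace false -- mandated namespace of this single-conjunct summit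

open TensorProduct IsLocalRing
open Literature.AlgebraicGeometry.Resolution

namespace Summit.ResolutionOfSingularities.ResolutionOfSingularities.Theorems

universe u

section Ring

variable {K k : Type u} [Field K] [Field k] [Algebra K k] {B : Type u} [CommRing B] [Algebra K B]
  [Algebra.FiniteType K B]

/-- **Descent at every level.** For an intermediate level `K → E → k` and a prime `𝔓` of
`B ⊗_K k`: if `(B ⊗_K k)_𝔓` is regular then so is `(B ⊗_K E)_{ι_E⁻¹ 𝔓}`, `ι_E` the base change
of `E → k` — `ι_E` is flat, so the induced local homomorphism is flat and regularity descends
(Matsumura 23.7 (i), tree `IsRegularLocalRing.of_flat_ringHom`). [cite: Matsumura1987, Thm. 23.7 (i)] -/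
theorem isRegularLocalRing_localization_comap_lTensor (E : Type u) [Field E] [Algebra K E]
    [Algebra E k] [IsScalarTower K E k] (𝔓 : Ideal (B ⊗[K] k)) [𝔓.IsPrime]
    (h : IsRegularLocalRing (Localization.AtPrime 𝔓)) :
    IsRegularLocalRing (Localization.AtPrime (𝔓.comap
      (Algebra.TensorProduct.lTensor (S := K) B (IsScalarTower.toAlgHom K E k)).toRingHom)) := by
  set ι := (Algebra.TensorProduct.lTensor (S := K) B (IsScalarTower.toAlgHom K E k)).toRingHom
    with hι
  haveI : IsNoetherianRing (B ⊗[K] E) := isNoetherianRing_tensor_of_finiteType E B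
  have hflat : ι.Flat :=
    RingHom.Flat.lTensor B (RingHom.Flat.of_isField (Field.toIsField E) _)
  have hf : (Localization.localRingHom (𝔓.comap ι) 𝔓 ι rfl).Flat :=
    hflat.localRingHom 𝔓 (𝔓.comap ι) rfl
  haveI : IsLocalHom (Localization.localRingHom (𝔓.comap ι) 𝔓 ι rfl) :=
    Localization.isLocalHom_localRingHom _ _ ι rfl
  haveI := h
  exact IsRegularLocalRing.of_flat_ringHom _ hf

variable (K k B) in
/-- **The regular locus of `B ⊗_K k` is open**: `B ⊗_K k ≅ k ⊗_K B` is a finitely generated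
`k`-algebra and fields are J-2 (Matsumura, Cor. to Thm. 30.5; tree
`isOpen_regularLocus_of_finiteType_field`), the regular locus being invariant under the ring
isomorphism (`mem_regularLocus_iff_of_ringEquiv`). [cite: Matsumura1987, §30, Cor. to Thm. 30.5] -/
theorem isOpen_regularLocus_tensor : IsOpen (regularLocus (B ⊗[K] k)) := by
  let e : k ⊗[K] B ≃ₐ[K] B ⊗[K] k := Algebra.TensorProduct.comm K k B
  have hopen : IsOpen (regularLocus (k ⊗[K] B)) :=
    isOpen_regularLocus_of_finiteType_field k (k ⊗[K] B)
  have heq : regularLocus (B ⊗[K] k) =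
      PrimeSpectrum.comap (e.toRingEquiv : k ⊗[K] B →+* B ⊗[K] k) ⁻¹'
        regularLocus (k ⊗[K] B) := by
    ext p
    rw [Set.mem_preimage]
    exact mem_regularLocus_iff_of_ringEquiv e.toRingEquiv p
  rw [heq]
  exact hopen.preimage (PrimeSpectrum.continuous_comap _)

variable (K k B) in
/-- **Uniform ascent at high levels (the singular locus descends to a finite level).** There is a
finite set `C ⊆ k` such that for every intermediate level `K → E → k` whose image contains `C` and
every prime `𝔓` of `B ⊗_K k`: if `(B ⊗_K E)_{ι_E⁻¹ 𝔓}` is regular then `(B ⊗_K k)_𝔓` is regular.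
`C` = the scalars of `k` occurring in generators of the finitely many generic points of the (closed)
singular locus of `Spec (B ⊗_K k)`; at those points the primes are extended from the level, so
regularity would ascend (Matsumura 23.7 (ii)); at the other singular points one generalizes first
(Serre). See the module docstring. [cite: Matsumura1987, Thm. 23.7] -/
theorem exists_finset_isRegularLocalRing_of_level :
    ∃ C : Finset k, ∀ (E : Type u) [Field E] [Algebra K E] [Algebra E k] [IsScalarTower K E k],
      (↑C : Set k) ⊆ Set.range (algebraMap E k) →
      ∀ (𝔓 : Ideal (B ⊗[K] k)) [𝔓.IsPrime],
        IsRegularLocalRing (Localization.AtPrime (𝔓.comap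
          (Algebra.TensorProduct.lTensor (S := K) B (IsScalarTower.toAlgHom K E k)).toRingHom)) →
        IsRegularLocalRing (Localization.AtPrime 𝔓) := by
  classical
  haveI : IsNoetherianRing (B ⊗[K] k) := isNoetherianRing_tensor_of_finiteType k B
  -- the singular locus `Z`, closed, and its vanishing ideal `J`
  set Z : Set (PrimeSpectrum (B ⊗[K] k)) := (regularLocus (B ⊗[K] k))ᶜ with hZ
  have hZc : IsClosed Z := (isOpen_regularLocus_tensor K k B).isClosed_compl
  set J : Ideal (B ⊗[K] k) := PrimeSpectrum.vanishingIdeal Z with hJ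
  have hZJ : PrimeSpectrum.zeroLocus (↑J : Set (B ⊗[K] k)) = Z := by
    rw [hJ, PrimeSpectrum.zeroLocus_vanishingIdeal_eq_closure, hZc.closure_eq]
  have hfin : (J.minimalPrimes).Finite := Ideal.finite_minimalPrimes_of_isNoetherianRing _ J
  -- generators of ideals and the scalars of tensors
  let gens : Ideal (B ⊗[K] k) → Finset (B ⊗[K] k) := fun I => (IsNoetherian.noetherian I).choose
  have hgens : ∀ I : Ideal (B ⊗[K] k), Ideal.span (↑(gens I) : Set (B ⊗[K] k)) = I :=
    fun I => (IsNoetherian.noetherian I).choose_spec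
  let F : B ⊗[K] k → Finset (B × k) := fun g => (TensorProduct.exists_finset (R := K) g).choose
  have hF : ∀ g : B ⊗[K] k, g = ∑ i ∈ F g, i.1 ⊗ₜ[K] i.2 :=
    fun g => (TensorProduct.exists_finset (R := K) g).choose_spec
  refine ⟨hfin.toFinset.biUnion fun q => (gens q).biUnion fun g => (F g).image Prod.snd, ?_⟩
  intro E _ _ _ _ hC 𝔓 _ hreg
  set ι := (Algebra.TensorProduct.lTensor (S := K) B (IsScalarTower.toAlgHom K E k)).toRingHom
    with hι
  by_contra h𝔓
  -- `𝔓` is a singular point; choose a generic point `q ≤ 𝔓` of the singular locus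
  have h𝔓Z : (⟨𝔓, ‹_›⟩ : PrimeSpectrum (B ⊗[K] k)) ∈ Z := by
    rw [hZ, Set.mem_compl_iff, mem_regularLocus]
    exact h𝔓
  have hJ𝔓 : J ≤ 𝔓 := by
    rw [← hZJ, PrimeSpectrum.mem_zeroLocus] at h𝔓Z
    exact fun x hx => h𝔓Z hx
  obtain ⟨q, hq, hq𝔓⟩ := Ideal.exists_minimalPrimes_le hJ𝔓
  haveI hqP : q.IsPrime := hq.1.1
  have hJq : J ≤ q := hq.1.2
  have hqZ : (⟨q, hqP⟩ : PrimeSpectrum (B ⊗[K] k)) ∈ Z := by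
    rw [← hZJ, PrimeSpectrum.mem_zeroLocus]
    exact fun x hx => hJq hx
  have hqsing : ¬ IsRegularLocalRing (Localization.AtPrime q) := by
    rw [hZ, Set.mem_compl_iff, mem_regularLocus] at hqZ
    exact hqZ
  apply hqsing
  -- the level is regular below `q` (generalization of its regularity below `𝔓`)
  haveI : IsNoetherianRing (B ⊗[K] E) := isNoetherianRing_tensor_of_finiteType E B
  have hregq : IsRegularLocalRing (Localization.AtPrime (q.comap ι)) := by
    have h1 : (⟨𝔓.comap ι, inferInstance⟩ : PrimeSpectrum (B ⊗[K] E)) ∈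
        regularLocus (B ⊗[K] E) := by
      rw [mem_regularLocus]
      exact hreg
    have h2 := mem_regularLocus_of_le (Q := ⟨q.comap ι, inferInstance⟩)
      ((PrimeSpectrum.asIdeal_le_asIdeal _ _).mp (Ideal.comap_mono hq𝔓)) h1
    rw [mem_regularLocus] at h2
    exact h2
  -- `q` is extended from the level: its generators have scalars in `C ⊆ E`
  have hgen : q ≤ (q.comap ι).map ι := by
    have hspan : Ideal.span (↑(gens q) : Set (B ⊗[K] k)) ≤ (q.comap ι).map ι := by
      refine Ideal.span_le.mpr fun g hg => ?_
      have hgq : g ∈ q := by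
        rw [← hgens q]
        exact Ideal.subset_span hg
      have hsc : ∀ i ∈ F g, i.2 ∈ Set.range (algebraMap E k) := by
        intro i hi
        refine hC ?_
        rw [Finset.coe_biUnion, Set.mem_iUnion₂]
        refine ⟨q, hfin.mem_toFinset.mpr hq, ?_⟩
        rw [Finset.coe_biUnion, Set.mem_iUnion₂]
        exact ⟨g, hg, Finset.mem_image_of_mem Prod.snd hi⟩
      obtain ⟨x, hx⟩ : ∑ i ∈ F g, i.1 ⊗ₜ[K] i.2 ∈ Set.range ι :=
        sum_tmul_mem_range_lTensor (F g) hsc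
      rw [← hF g] at hx
      rw [SetLike.mem_coe, ← hx]
      refine Ideal.mem_map_of_mem ι ?_
      rw [Ideal.mem_comap, hx]
      exact hgq
    rwa [hgens q] at hspan
  -- ascent along the flat local map with trivial closed fibre
  exact isRegularLocalRing_localization_of_le_map_comap q hgen hregq

variable (K k B) in
/-- **The singular locus of `B ⊗_K k` is the preimage of the singular locus of a high enough
level**, pointwise: there is a finite `C ⊆ k` such that for every intermediate level `E ⊇ C` and
every prime `𝔓` of `B ⊗_K k`, `(B ⊗_K k)_𝔓` is regular iff `(B ⊗_K E)_{ι_E⁻¹ 𝔓}` is regular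
(`⟹` at every level by flat descent; `⟸` by `exists_finset_isRegularLocalRing_of_level`).
[cite: Matsumura1987, Thm. 23.7] -/
theorem exists_finset_isRegularLocalRing_iff_level :
    ∃ C : Finset k, ∀ (E : Type u) [Field E] [Algebra K E] [Algebra E k] [IsScalarTower K E k],
      (↑C : Set k) ⊆ Set.range (algebraMap E k) →
      ∀ (𝔓 : Ideal (B ⊗[K] k)) [𝔓.IsPrime],
        IsRegularLocalRing (Localization.AtPrime 𝔓) ↔
        IsRegularLocalRing (Localization.AtPrime (𝔓.comap
          (Algebra.TensorProduct.lTensor (S := K) B (IsScalarTower.toAlgHom K E k)).toRingHom)) := by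
  obtain ⟨C, hC⟩ := exists_finset_isRegularLocalRing_of_level K k B
  exact ⟨C, fun E _ _ _ _ hCE 𝔓 _ =>
    ⟨fun h => isRegularLocalRing_localization_comap_lTensor E 𝔓 h, hC E hCE 𝔓⟩⟩

variable (K k B) in
/-- **`B ⊗_K k` is regular iff a high enough level `B ⊗_K E` is regular**: there is a finite
`C ⊆ k` such that for every intermediate level `E ⊇ C`, all local rings of `B ⊗_K E` are regular
iff all local rings of `B ⊗_K k` are regular. (`⟸` holds at every level: faithfully flat descent,
tree `isRegularLocalRing_localization_of_overfield`; `⟹` is false at low levels in general —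
Kollár's curve `y² = x^p − t`, tree `RegularNotGeometricallyRegular`.)
[cite: Matsumura1987, Thm. 23.7] -/
theorem exists_finset_forall_isRegularLocalRing_iff_level :
    ∃ C : Finset k, ∀ (E : Type u) [Field E] [Algebra K E] [Algebra E k] [IsScalarTower K E k],
      (↑C : Set k) ⊆ Set.range (algebraMap E k) →
      ((∀ (𝔓' : Ideal (B ⊗[K] E)) [𝔓'.IsPrime], IsRegularLocalRing (Localization.AtPrime 𝔓')) ↔
        ∀ (𝔓 : Ideal (B ⊗[K] k)) [𝔓.IsPrime], IsRegularLocalRing (Localization.AtPrime 𝔓)) := by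
  obtain ⟨C, hC⟩ := exists_finset_isRegularLocalRing_of_level K k B
  refine ⟨C, fun E _ _ _ _ hCE => ⟨fun hE 𝔓 _ => hC E hCE 𝔓 (hE _), fun hk 𝔓' _ => ?_⟩⟩
  haveI : IsNoetherianRing (B ⊗[K] E) := isNoetherianRing_tensor_of_finiteType E B
  exact isRegularLocalRing_localization_of_overfield (Ω := k) (fun 𝔔 => hk 𝔔.asIdeal) 𝔓'

end Ring

end Summit.ResolutionOfSingularities.ResolutionOfSingularities.Theorems

end
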